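import Mathlib
import HarnessLib

/-!
# Route `KLProgramme` — crux K3 ENGINE (stmt-HubbardSuperconductivity-20437) stub (b) conj. 2 «(c-D)² FAMILY TELESCOPE», brick (D5l): the ELEVEN
# THRESHOLDS of the family piece from ONE scale condition `W ≤ x₀` and two rate conditions `ℭρ³ ≤ 8/π³`, `3𝔴ρ₃² ≤ 16/π²`

Cell `gate-hubbard-kl`, seat hubbard-kl-k3c3-p2 (g11); F1-DESIGN §10.  The family piece (`…EngineSliceFamPieceTel`) asks
`4C_kρ³ ≤ K_c x₀^{3−k}` (`k = 0…3`, iso and tangent families) and `3C^w_kρ₃² ≤ K_w x₀^{2−k}` (`k = 0,1,2`), where the `C`'s are the explicit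
polynomials in `k₁ = (16B₁+16)/Λ², k₂, k₃`, `c = βL²`, the band sizes `b_s, b₂, b₂′, b₃, b₃′` and the relative rate coefficients `r_{kℓ}`, `rv_{kℓ}`.
Given the uniform sizes `r_{kℓ}, rv_{kℓ} ≤ Q·Y^{k−ℓ}` (`…EngineSliceFamRateAtoms`) and ONE scale majorant `W` (`1/Λ ≤ W`, `Y ≤ W`, `1 ≤ Y`):

* `famC0_le`, `famC1_le`, `famC2_le`, `famC3_le`, `famCw0_le`, `famCw1_le`, `famCw2_le` — `C ≤ (c/Λ)·ℭ·W^{deg}` shape by shape;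
* **`famIncr_thresholds_of_scale`** — with `ℭ := ℭ₀ + ℭ₁ + ℭ₂ + ℭ₃`, `𝔴 := 𝔴₀ + 𝔴₁ + 𝔴₂` (explicit, `Λ`-free), `ℭρ³ ≤ 8/π³`, `3𝔴ρ₃² ≤ 16/π²`
  and `W ≤ x₀`: all eleven thresholds, literally in the binder form of `rowSumWt_sliceCT_famDefect_pieceTel_le`.

Pure real-arithmetic bookkeeping; no definitions, no sorry. [folklore]
-/

noncomputable section

namespace Summit.HubbardSuperconductivity.HubbardSuperconductivity.Theorems.TorusFourierL2

set_option linter.dupNamespace false -- summit = problem name (single-conjunct summit), D-0017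

open Real

section Shapes

variable {Λ c W Y Q bs b₂ b₂' b₃ b₃' K1 K2 K3 k₁ k₂ k₃ r₁₀ r₁₁ r₂₀ r₂₁ r₂₂ r₃₀ r₃₁ r₃₂ r₃₃ : ℝ}
  (hΛ : 0 < Λ) (hc : 0 < c) (hY1 : 1 ≤ Y) (hYW : Y ≤ W) (hΛW : 1 / Λ ≤ W) (hQ : 0 ≤ Q)
  (hbs : 0 ≤ bs) (hb₂ : 0 ≤ b₂) (hb₂' : 0 ≤ b₂') (hb₃ : 0 ≤ b₃) (hb₃' : 0 ≤ b₃') (hK1 : 0 ≤ K1) (hK2 : 0 ≤ K2) (hK3 : 0 ≤ K3)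
  (hk₁ : k₁ = K1 / Λ ^ 2) (hk₂ : k₂ = K2 / Λ ^ 3) (hk₃ : k₃ = K3 / Λ ^ 4)
  (hr₁₀ : r₁₀ ≤ Q * Y) (hr₁₁ : r₁₁ ≤ Q) (hr₂₀ : r₂₀ ≤ Q * Y ^ 2) (hr₂₁ : r₂₁ ≤ Q * Y) (hr₂₂ : r₂₂ ≤ Q)
  (hr₃₀ : r₃₀ ≤ Q * Y ^ 3) (hr₃₁ : r₃₁ ≤ Q * Y ^ 2) (hr₃₂ : r₃₂ ≤ Q * Y)

include hΛ hc hY1 hYW hΛW hQ hbs hb₂ hb₃ hK1 hK2 hK3 hk₁ hk₂ hk₃ hr₁₀ hr₂₀ hr₃₀ in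
/-- Shape `C₀`: `343k₃c b_s³ + 21k₂c b_s b₂ + k₁c b₃ + 3r₁₀(36k₂c b_s² + k₁c b₂) + 15r₂₀k₁c b_s + r₃₀(4c/Λ) ≤ (c/Λ)·ℭ₀·W³`. [folklore] -/
theorem famC0_le :
    343 * k₃ * c * bs ^ 3 + 21 * k₂ * c * bs * b₂ + k₁ * c * b₃ + 3 * r₁₀ * (36 * k₂ * c * bs ^ 2 + k₁ * c * b₂) + 15 * r₂₀ * k₁ * c * bs +
        r₃₀ * (4 * c / Λ) ≤
      c / Λ * (343 * K3 * bs ^ 3 + 21 * K2 * bs * b₂ + K1 * b₃ + 3 * Q * (36 * K2 * bs ^ 2 + K1 * b₂) + 15 * Q * K1 * bs + 4 * Q) * W ^ 3 := by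
  have hW1 : 1 ≤ W := hY1.trans hYW
  have hW0 : 0 ≤ W := zero_le_one.trans hW1
  have hY0 : 0 ≤ Y := zero_le_one.trans hY1
  have hu0 : 0 ≤ 1 / Λ := by positivity
  have hW2 : W ≤ W ^ 2 := by nlinarith only [hW1]
  have hW3 : W ^ 2 ≤ W ^ 3 := by nlinarith only [hW1, hW0]
  have hYW2 : Y ^ 2 ≤ W ^ 2 := pow_le_pow_left₀ hY0 hYW 2
  have hYW3 : Y ^ 3 ≤ W ^ 3 := pow_le_pow_left₀ hY0 hYW 3
  have hu2 : (1 / Λ) ^ 2 ≤ W ^ 2 := pow_le_pow_left₀ hu0 hΛW 2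
  have hu3 : (1 / Λ) ^ 3 ≤ W ^ 3 := pow_le_pow_left₀ hu0 hΛW 3
  have e : 343 * k₃ * c * bs ^ 3 + 21 * k₂ * c * bs * b₂ + k₁ * c * b₃ + 3 * r₁₀ * (36 * k₂ * c * bs ^ 2 + k₁ * c * b₂) + 15 * r₂₀ * k₁ * c * bs +
        r₃₀ * (4 * c / Λ) =
      c / Λ * (343 * K3 * bs ^ 3 * (1 / Λ) ^ 3 + 21 * K2 * bs * b₂ * (1 / Λ) ^ 2 + K1 * b₃ * (1 / Λ) +
        3 * r₁₀ * (36 * K2 * bs ^ 2 * (1 / Λ) ^ 2 + K1 * b₂ * (1 / Λ)) + 15 * r₂₀ * K1 * bs * (1 / Λ) + 4 * r₃₀) := by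
    rw [hk₁, hk₂, hk₃]; field_simp
  rw [e, mul_assoc (c / Λ)]
  refine mul_le_mul_of_nonneg_left ?_ (by positivity)
  have t1 : 343 * K3 * bs ^ 3 * (1 / Λ) ^ 3 ≤ 343 * K3 * bs ^ 3 * W ^ 3 := mul_le_mul_of_nonneg_left hu3 (by positivity)
  have t2 : 21 * K2 * bs * b₂ * (1 / Λ) ^ 2 ≤ 21 * K2 * bs * b₂ * W ^ 3 := mul_le_mul_of_nonneg_left (hu2.trans hW3) (by positivity)
  have t3 : K1 * b₃ * (1 / Λ) ≤ K1 * b₃ * W ^ 3 := mul_le_mul_of_nonneg_left (hΛW.trans (hW2.trans hW3)) (by positivity)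
  have t4 : 3 * r₁₀ * (36 * K2 * bs ^ 2 * (1 / Λ) ^ 2 + K1 * b₂ * (1 / Λ)) ≤ 3 * Q * (36 * K2 * bs ^ 2 + K1 * b₂) * W ^ 3 := by
    have hbr0 : 0 ≤ 36 * K2 * bs ^ 2 * (1 / Λ) ^ 2 + K1 * b₂ * (1 / Λ) := by positivity
    have hbr : 36 * K2 * bs ^ 2 * (1 / Λ) ^ 2 + K1 * b₂ * (1 / Λ) ≤ (36 * K2 * bs ^ 2 + K1 * b₂) * W ^ 2 := by
      have v1 : 36 * K2 * bs ^ 2 * (1 / Λ) ^ 2 ≤ 36 * K2 * bs ^ 2 * W ^ 2 := mul_le_mul_of_nonneg_left hu2 (by positivity)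
      have v2 : K1 * b₂ * (1 / Λ) ≤ K1 * b₂ * W ^ 2 := mul_le_mul_of_nonneg_left (hΛW.trans hW2) (by positivity)
      nlinarith only [v1, v2]
    have h1 : r₁₀ * (36 * K2 * bs ^ 2 * (1 / Λ) ^ 2 + K1 * b₂ * (1 / Λ)) ≤ (Q * Y) * ((36 * K2 * bs ^ 2 + K1 * b₂) * W ^ 2) :=
      mul_le_mul hr₁₀ hbr hbr0 (by positivity)
    have h2 : (Q * Y) * ((36 * K2 * bs ^ 2 + K1 * b₂) * W ^ 2) ≤ (Q * W) * ((36 * K2 * bs ^ 2 + K1 * b₂) * W ^ 2) := by gcongr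
    calc 3 * r₁₀ * (36 * K2 * bs ^ 2 * (1 / Λ) ^ 2 + K1 * b₂ * (1 / Λ)) = 3 * (r₁₀ * (36 * K2 * bs ^ 2 * (1 / Λ) ^ 2 + K1 * b₂ * (1 / Λ))) := by ring
      _ ≤ 3 * ((Q * W) * ((36 * K2 * bs ^ 2 + K1 * b₂) * W ^ 2)) := by linarith only [h1, h2]
      _ = 3 * Q * (36 * K2 * bs ^ 2 + K1 * b₂) * W ^ 3 := by ring
  have t5 : 15 * r₂₀ * K1 * bs * (1 / Λ) ≤ 15 * Q * K1 * bs * W ^ 3 := by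
    have e5 : 15 * r₂₀ * K1 * bs * (1 / Λ) = r₂₀ * (15 * K1 * bs * (1 / Λ)) := by ring
    rw [e5]
    calc r₂₀ * (15 * K1 * bs * (1 / Λ)) ≤ (Q * Y ^ 2) * (15 * K1 * bs * W) :=
          mul_le_mul hr₂₀ (mul_le_mul_of_nonneg_left hΛW (by positivity)) (by positivity) (by positivity)
      _ ≤ (Q * W ^ 2) * (15 * K1 * bs * W) := by gcongr
      _ = 15 * Q * K1 * bs * W ^ 3 := by ring
  have t6 : 4 * r₃₀ ≤ 4 * Q * W ^ 3 := by nlinarith only [hr₃₀, hYW3, hQ]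
  nlinarith only [t1, t2, t3, t4, t5, t6]

include hΛ hc hY1 hYW hΛW hQ hbs hb₂ hb₂' hb₃' hK1 hK2 hk₁ hk₂ hr₁₀ hr₁₁ hr₂₁ hr₃₁ in
/-- Shape `C₁′`: `21k₂c b_s b₂′ + k₁c b₃′ + 3r₁₁(36k₂c b_s² + k₁c b₂) + 3r₁₀(k₁c b₂′) + 15r₂₁k₁c b_s + r₃₁(4c/Λ) ≤ (c/Λ)·ℭ₁·W²`. [folklore] -/
theorem famC1_le :
    21 * k₂ * c * bs * b₂' + k₁ * c * b₃' + 3 * r₁₁ * (36 * k₂ * c * bs ^ 2 + k₁ * c * b₂) + 3 * r₁₀ * (k₁ * c * b₂') + 15 * r₂₁ * k₁ * c * bs +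
        r₃₁ * (4 * c / Λ) ≤
      c / Λ * (21 * K2 * bs * b₂' + K1 * b₃' + 3 * Q * (36 * K2 * bs ^ 2 + K1 * b₂) + 3 * Q * (K1 * b₂') + 15 * Q * K1 * bs + 4 * Q) * W ^ 2 := by
  have hW1 : 1 ≤ W := hY1.trans hYW
  have hW0 : 0 ≤ W := zero_le_one.trans hW1
  have hY0 : 0 ≤ Y := zero_le_one.trans hY1
  have hu0 : 0 ≤ 1 / Λ := by positivity
  have hW2 : W ≤ W ^ 2 := by nlinarith only [hW1]
  have h1W2 : (1 : ℝ) ≤ W ^ 2 := hW1.trans hW2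
  have hYW2 : Y ^ 2 ≤ W ^ 2 := pow_le_pow_left₀ hY0 hYW 2
  have hu2 : (1 / Λ) ^ 2 ≤ W ^ 2 := pow_le_pow_left₀ hu0 hΛW 2
  have e : 21 * k₂ * c * bs * b₂' + k₁ * c * b₃' + 3 * r₁₁ * (36 * k₂ * c * bs ^ 2 + k₁ * c * b₂) + 3 * r₁₀ * (k₁ * c * b₂') + 15 * r₂₁ * k₁ * c * bs +
        r₃₁ * (4 * c / Λ) =
      c / Λ * (21 * K2 * bs * b₂' * (1 / Λ) ^ 2 + K1 * b₃' * (1 / Λ) + 3 * r₁₁ * (36 * K2 * bs ^ 2 * (1 / Λ) ^ 2 + K1 * b₂ * (1 / Λ)) +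
        3 * r₁₀ * (K1 * b₂' * (1 / Λ)) + 15 * r₂₁ * K1 * bs * (1 / Λ) + 4 * r₃₁) := by
    rw [hk₁, hk₂]; field_simp
  rw [e, mul_assoc (c / Λ)]
  refine mul_le_mul_of_nonneg_left ?_ (by positivity)
  have t1 : 21 * K2 * bs * b₂' * (1 / Λ) ^ 2 ≤ 21 * K2 * bs * b₂' * W ^ 2 := mul_le_mul_of_nonneg_left hu2 (by positivity)
  have t2 : K1 * b₃' * (1 / Λ) ≤ K1 * b₃' * W ^ 2 := mul_le_mul_of_nonneg_left (hΛW.trans hW2) (by positivity)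
  have t3 : 3 * r₁₁ * (36 * K2 * bs ^ 2 * (1 / Λ) ^ 2 + K1 * b₂ * (1 / Λ)) ≤ 3 * Q * (36 * K2 * bs ^ 2 + K1 * b₂) * W ^ 2 := by
    have hbr0 : 0 ≤ 36 * K2 * bs ^ 2 * (1 / Λ) ^ 2 + K1 * b₂ * (1 / Λ) := by positivity
    have hbr : 36 * K2 * bs ^ 2 * (1 / Λ) ^ 2 + K1 * b₂ * (1 / Λ) ≤ (36 * K2 * bs ^ 2 + K1 * b₂) * W ^ 2 := by
      have v1 : 36 * K2 * bs ^ 2 * (1 / Λ) ^ 2 ≤ 36 * K2 * bs ^ 2 * W ^ 2 := mul_le_mul_of_nonneg_left hu2 (by positivity)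
      have v2 : K1 * b₂ * (1 / Λ) ≤ K1 * b₂ * W ^ 2 := mul_le_mul_of_nonneg_left (hΛW.trans hW2) (by positivity)
      nlinarith only [v1, v2]
    have h1 : r₁₁ * (36 * K2 * bs ^ 2 * (1 / Λ) ^ 2 + K1 * b₂ * (1 / Λ)) ≤ Q * ((36 * K2 * bs ^ 2 + K1 * b₂) * W ^ 2) := mul_le_mul hr₁₁ hbr hbr0 hQ
    calc 3 * r₁₁ * (36 * K2 * bs ^ 2 * (1 / Λ) ^ 2 + K1 * b₂ * (1 / Λ)) = 3 * (r₁₁ * (36 * K2 * bs ^ 2 * (1 / Λ) ^ 2 + K1 * b₂ * (1 / Λ))) := by ring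
      _ ≤ 3 * (Q * ((36 * K2 * bs ^ 2 + K1 * b₂) * W ^ 2)) := by linarith only [h1]
      _ = _ := by ring
  have t4 : 3 * r₁₀ * (K1 * b₂' * (1 / Λ)) ≤ 3 * Q * (K1 * b₂') * W ^ 2 := by
    have h0 : K1 * b₂' * (1 / Λ) ≤ K1 * b₂' * W := mul_le_mul_of_nonneg_left hΛW (by positivity)
    have h1 : r₁₀ * (K1 * b₂' * (1 / Λ)) ≤ (Q * Y) * (K1 * b₂' * W) := mul_le_mul hr₁₀ h0 (by positivity) (by positivity)
    have h2 : (Q * Y) * (K1 * b₂' * W) ≤ (Q * W) * (K1 * b₂' * W) := by gcongr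
    calc 3 * r₁₀ * (K1 * b₂' * (1 / Λ)) = 3 * (r₁₀ * (K1 * b₂' * (1 / Λ))) := by ring
      _ ≤ 3 * ((Q * W) * (K1 * b₂' * W)) := by linarith only [h1, h2]
      _ = _ := by ring
  have t5 : 15 * r₂₁ * K1 * bs * (1 / Λ) ≤ 15 * Q * K1 * bs * W ^ 2 := by
    have e5 : 15 * r₂₁ * K1 * bs * (1 / Λ) = r₂₁ * (15 * K1 * bs * (1 / Λ)) := by ring
    rw [e5]
    calc r₂₁ * (15 * K1 * bs * (1 / Λ)) ≤ (Q * Y) * (15 * K1 * bs * W) :=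
          mul_le_mul hr₂₁ (mul_le_mul_of_nonneg_left hΛW (by positivity)) (by positivity) (by positivity)
      _ ≤ (Q * W) * (15 * K1 * bs * W) := by gcongr
      _ = _ := by ring
  have t6 : 4 * r₃₁ ≤ 4 * Q * W ^ 2 := by nlinarith only [hr₃₁, hYW2, hQ]
  nlinarith only [t1, t2, t3, t4, t5, t6]

include hΛ hc hY1 hYW hΛW hQ hbs hb₂' hK1 hk₁ hr₁₁ hr₂₂ hr₃₂ in
/-- Shape `C₂`: `3r₁₁(k₁c b₂′) + 15r₂₂k₁c b_s + r₃₂(4c/Λ) ≤ (c/Λ)·ℭ₂·W`. [folklore] -/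
theorem famC2_le :
    3 * r₁₁ * (k₁ * c * b₂') + 15 * r₂₂ * k₁ * c * bs + r₃₂ * (4 * c / Λ) ≤ c / Λ * (3 * Q * (K1 * b₂') + 15 * Q * K1 * bs + 4 * Q) * W := by
  have hW1 : 1 ≤ W := hY1.trans hYW
  have hW0 : 0 ≤ W := zero_le_one.trans hW1
  have hu0 : 0 ≤ 1 / Λ := by positivity
  have e : 3 * r₁₁ * (k₁ * c * b₂') + 15 * r₂₂ * k₁ * c * bs + r₃₂ * (4 * c / Λ) =
      c / Λ * (3 * r₁₁ * (K1 * b₂' * (1 / Λ)) + 15 * r₂₂ * K1 * bs * (1 / Λ) + 4 * r₃₂) := by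
    rw [hk₁]; field_simp
  rw [e, mul_assoc (c / Λ)]
  refine mul_le_mul_of_nonneg_left ?_ (by positivity)
  have t1 : 3 * r₁₁ * (K1 * b₂' * (1 / Λ)) ≤ 3 * Q * (K1 * b₂') * W := by
    have h0 : K1 * b₂' * (1 / Λ) ≤ K1 * b₂' * W := mul_le_mul_of_nonneg_left hΛW (by positivity)
    have h1 : r₁₁ * (K1 * b₂' * (1 / Λ)) ≤ Q * (K1 * b₂' * W) := mul_le_mul hr₁₁ h0 (by positivity) hQ
    calc 3 * r₁₁ * (K1 * b₂' * (1 / Λ)) = 3 * (r₁₁ * (K1 * b₂' * (1 / Λ))) := by ring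
      _ ≤ 3 * (Q * (K1 * b₂' * W)) := by linarith only [h1]
      _ = _ := by ring
  have t2 : 15 * r₂₂ * K1 * bs * (1 / Λ) ≤ 15 * Q * K1 * bs * W := by
    have e2 : 15 * r₂₂ * K1 * bs * (1 / Λ) = r₂₂ * (15 * K1 * bs * (1 / Λ)) := by ring
    rw [e2]
    calc r₂₂ * (15 * K1 * bs * (1 / Λ)) ≤ Q * (15 * K1 * bs * W) :=
          mul_le_mul hr₂₂ (mul_le_mul_of_nonneg_left hΛW (by positivity)) (by positivity) hQ
      _ = _ := by ring
  have t3 : 4 * r₃₂ ≤ 4 * Q * W := by nlinarith only [hr₃₂, hYW, hQ]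
  nlinarith only [t1, t2, t3]

include hΛ hc hY1 hYW hQ hbs hb₂ hK1 hK2 hk₁ hk₂ hΛW hr₁₀ hr₂₀ in
/-- Shape `C^w₀`: `25k₂c b_s² + k₁c b₂ + 8r₁₀k₁c b_s + r₂₀(4c/Λ) ≤ (c/Λ)·𝔴₀·W²`. [folklore] -/
theorem famCw0_le :
    25 * k₂ * c * bs ^ 2 + k₁ * c * b₂ + 8 * r₁₀ * k₁ * c * bs + r₂₀ * (4 * c / Λ) ≤
      c / Λ * (25 * K2 * bs ^ 2 + K1 * b₂ + 8 * Q * K1 * bs + 4 * Q) * W ^ 2 := by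
  have hW1 : 1 ≤ W := hY1.trans hYW
  have hW0 : 0 ≤ W := zero_le_one.trans hW1
  have hY0 : 0 ≤ Y := zero_le_one.trans hY1
  have hu0 : 0 ≤ 1 / Λ := by positivity
  have hW2 : W ≤ W ^ 2 := by nlinarith only [hW1]
  have hYW2 : Y ^ 2 ≤ W ^ 2 := pow_le_pow_left₀ hY0 hYW 2
  have hu2 : (1 / Λ) ^ 2 ≤ W ^ 2 := pow_le_pow_left₀ hu0 hΛW 2
  have e : 25 * k₂ * c * bs ^ 2 + k₁ * c * b₂ + 8 * r₁₀ * k₁ * c * bs + r₂₀ * (4 * c / Λ) =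
      c / Λ * (25 * K2 * bs ^ 2 * (1 / Λ) ^ 2 + K1 * b₂ * (1 / Λ) + 8 * r₁₀ * K1 * bs * (1 / Λ) + 4 * r₂₀) := by
    rw [hk₁, hk₂]; field_simp
  rw [e, mul_assoc (c / Λ)]
  refine mul_le_mul_of_nonneg_left ?_ (by positivity)
  have t1 : 25 * K2 * bs ^ 2 * (1 / Λ) ^ 2 ≤ 25 * K2 * bs ^ 2 * W ^ 2 := mul_le_mul_of_nonneg_left hu2 (by positivity)
  have t2 : K1 * b₂ * (1 / Λ) ≤ K1 * b₂ * W ^ 2 := mul_le_mul_of_nonneg_left (hΛW.trans hW2) (by positivity)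
  have t3 : 8 * r₁₀ * K1 * bs * (1 / Λ) ≤ 8 * Q * K1 * bs * W ^ 2 := by
    have e3 : 8 * r₁₀ * K1 * bs * (1 / Λ) = r₁₀ * (8 * K1 * bs * (1 / Λ)) := by ring
    rw [e3]
    calc r₁₀ * (8 * K1 * bs * (1 / Λ)) ≤ (Q * Y) * (8 * K1 * bs * W) :=
          mul_le_mul hr₁₀ (mul_le_mul_of_nonneg_left hΛW (by positivity)) (by positivity) (by positivity)
      _ ≤ (Q * W) * (8 * K1 * bs * W) := by gcongr
      _ = _ := by ring
  have t4 : 4 * r₂₀ ≤ 4 * Q * W ^ 2 := by nlinarith only [hr₂₀, hYW2, hQ]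
  nlinarith only [t1, t2, t3, t4]

include hΛ hc hY1 hYW hQ hbs hb₂' hK1 hk₁ hΛW hr₁₁ hr₂₁ in
/-- Shape `C^w₁`: `k₁c b₂′ + 8r₁₁k₁c b_s + r₂₁(4c/Λ) ≤ (c/Λ)·𝔴₁·W`. [folklore] -/
theorem famCw1_le :
    k₁ * c * b₂' + 8 * r₁₁ * k₁ * c * bs + r₂₁ * (4 * c / Λ) ≤ c / Λ * (K1 * b₂' + 8 * Q * K1 * bs + 4 * Q) * W := by
  have hW1 : 1 ≤ W := hY1.trans hYW
  have hW0 : 0 ≤ W := zero_le_one.trans hW1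
  have hu0 : 0 ≤ 1 / Λ := by positivity
  have e : k₁ * c * b₂' + 8 * r₁₁ * k₁ * c * bs + r₂₁ * (4 * c / Λ) =
      c / Λ * (K1 * b₂' * (1 / Λ) + 8 * r₁₁ * K1 * bs * (1 / Λ) + 4 * r₂₁) := by
    rw [hk₁]; field_simp
  rw [e, mul_assoc (c / Λ)]
  refine mul_le_mul_of_nonneg_left ?_ (by positivity)
  have t1 : K1 * b₂' * (1 / Λ) ≤ K1 * b₂' * W := mul_le_mul_of_nonneg_left hΛW (by positivity)
  have t2 : 8 * r₁₁ * K1 * bs * (1 / Λ) ≤ 8 * Q * K1 * bs * W := by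
    have e2 : 8 * r₁₁ * K1 * bs * (1 / Λ) = r₁₁ * (8 * K1 * bs * (1 / Λ)) := by ring
    rw [e2]
    calc r₁₁ * (8 * K1 * bs * (1 / Λ)) ≤ Q * (8 * K1 * bs * W) :=
          mul_le_mul hr₁₁ (mul_le_mul_of_nonneg_left hΛW (by positivity)) (by positivity) hQ
      _ = _ := by ring
  have t3 : 4 * r₂₁ ≤ 4 * Q * W := by nlinarith only [hr₂₁, hYW, hQ]
  nlinarith only [t1, t2, t3]

end Shapes

set_option maxHeartbeats 1600000 in
/-- **The eleven thresholds of the family piece from `W ≤ x₀`, `ℭρ³ ≤ 8/π³`, `3𝔴ρ₃² ≤ 16/π²`** (see the module docstring). [folklore] -/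
theorem famIncr_thresholds_of_scale {Λ c W Y Q ρ ρ₃ x₀ bs b₂ b₂' b₃ b₃' B₁ B₂ B₃ k₁ k₂ k₃ Kc Kw ℭ 𝔴
    r₁₀ r₁₁ r₂₀ r₂₁ r₂₂ r₃₀ r₃₁ r₃₂ r₃₃ rv₁₀ rv₁₁ rv₂₀ rv₂₁ rv₂₂ rv₃₀ rv₃₁ rv₃₂ rv₃₃ C₀ C₁' C₂ C₃ Cv₀ Cv₁ Cv₂ Cv₃ Cw₀ Cw₁ Cw₂ : ℝ}
    (hΛ : 0 < Λ) (hc : 0 < c) (hY1 : 1 ≤ Y) (hYW : Y ≤ W) (hΛW : 1 / Λ ≤ W) (hQ : 0 ≤ Q) (hρ : 0 < ρ) (hρ₃ : 0 < ρ₃) (hx₀ : W ≤ x₀)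
    (hbs : 0 ≤ bs) (hb₂ : 0 ≤ b₂) (hb₂' : 0 ≤ b₂') (hb₃ : 0 ≤ b₃) (hb₃' : 0 ≤ b₃') (hB₁ : 0 ≤ B₁) (hB₂ : 0 ≤ B₂) (hB₃ : 0 ≤ B₃)
    (hr₁₀ : r₁₀ ≤ Q * Y) (hr₁₁ : r₁₁ ≤ Q) (hr₂₀ : r₂₀ ≤ Q * Y ^ 2) (hr₂₁ : r₂₁ ≤ Q * Y) (hr₂₂ : r₂₂ ≤ Q)
    (hr₃₀ : r₃₀ ≤ Q * Y ^ 3) (hr₃₁ : r₃₁ ≤ Q * Y ^ 2) (hr₃₂ : r₃₂ ≤ Q * Y) (hr₃₃ : r₃₃ ≤ Q)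
    (hrv₁₀ : rv₁₀ ≤ Q * Y) (hrv₁₁ : rv₁₁ ≤ Q) (hrv₂₀ : rv₂₀ ≤ Q * Y ^ 2) (hrv₂₁ : rv₂₁ ≤ Q * Y) (hrv₂₂ : rv₂₂ ≤ Q)
    (hrv₃₀ : rv₃₀ ≤ Q * Y ^ 3) (hrv₃₁ : rv₃₁ ≤ Q * Y ^ 2) (hrv₃₂ : rv₃₂ ≤ Q * Y) (hrv₃₃ : rv₃₃ ≤ Q)
    (hk₁ : k₁ = (16 * B₁ + 16) / Λ ^ 2) (hk₂ : k₂ = (32 * B₂ + 144 * B₁ + 128) / Λ ^ 3) (hk₃ : k₃ = (64 * B₃ + 480 * B₂ + 1728 * B₁ + 1536) / Λ ^ 4)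
    (hC₀ : C₀ = 343 * k₃ * c * bs ^ 3 + 21 * k₂ * c * bs * b₂ + k₁ * c * b₃ +
      3 * r₁₀ * (36 * k₂ * c * bs ^ 2 + k₁ * c * b₂) + 15 * r₂₀ * k₁ * c * bs + r₃₀ * (4 * c / Λ))
    (hC₁' : C₁' = 21 * k₂ * c * bs * b₂' + k₁ * c * b₃' + 3 * r₁₁ * (36 * k₂ * c * bs ^ 2 + k₁ * c * b₂) +
      3 * r₁₀ * (k₁ * c * b₂') + 15 * r₂₁ * k₁ * c * bs + r₃₁ * (4 * c / Λ))
    (hC₂ : C₂ = 3 * r₁₁ * (k₁ * c * b₂') + 15 * r₂₂ * k₁ * c * bs + r₃₂ * (4 * c / Λ))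
    (hC₃ : C₃ = r₃₃ * (4 * c / Λ))
    (hCv₀ : Cv₀ = 343 * k₃ * c * bs ^ 3 + 21 * k₂ * c * bs * b₂ + k₁ * c * b₃ +
      3 * rv₁₀ * (36 * k₂ * c * bs ^ 2 + k₁ * c * b₂) + 15 * rv₂₀ * k₁ * c * bs + rv₃₀ * (4 * c / Λ))
    (hCv₁ : Cv₁ = 21 * k₂ * c * bs * b₂' + k₁ * c * b₃' + 3 * rv₁₁ * (36 * k₂ * c * bs ^ 2 + k₁ * c * b₂) +
      3 * rv₁₀ * (k₁ * c * b₂') + 15 * rv₂₁ * k₁ * c * bs + rv₃₁ * (4 * c / Λ))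
    (hCv₂ : Cv₂ = 3 * rv₁₁ * (k₁ * c * b₂') + 15 * rv₂₂ * k₁ * c * bs + rv₃₂ * (4 * c / Λ))
    (hCv₃ : Cv₃ = rv₃₃ * (4 * c / Λ))
    (hCw₀ : Cw₀ = 25 * k₂ * c * bs ^ 2 + k₁ * c * b₂ + 8 * rv₁₀ * k₁ * c * bs + rv₂₀ * (4 * c / Λ))
    (hCw₁ : Cw₁ = k₁ * c * b₂' + 8 * rv₁₁ * k₁ * c * bs + rv₂₁ * (4 * c / Λ))
    (hCw₂ : Cw₂ = rv₂₂ * (4 * c / Λ))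
    (hKc : Kc = 32 * c / (π ^ 3 * Λ)) (hKw : Kw = 16 * c / (π ^ 2 * Λ))
    (hℭ : ℭ = (343 * (64 * B₃ + 480 * B₂ + 1728 * B₁ + 1536) * bs ^ 3 + 21 * (32 * B₂ + 144 * B₁ + 128) * bs * b₂ + (16 * B₁ + 16) * b₃ +
        3 * Q * (36 * (32 * B₂ + 144 * B₁ + 128) * bs ^ 2 + (16 * B₁ + 16) * b₂) + 15 * Q * (16 * B₁ + 16) * bs + 4 * Q) +
      (21 * (32 * B₂ + 144 * B₁ + 128) * bs * b₂' + (16 * B₁ + 16) * b₃' + 3 * Q * (36 * (32 * B₂ + 144 * B₁ + 128) * bs ^ 2 + (16 * B₁ + 16) * b₂) +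
        3 * Q * ((16 * B₁ + 16) * b₂') + 15 * Q * (16 * B₁ + 16) * bs + 4 * Q) +
      (3 * Q * ((16 * B₁ + 16) * b₂') + 15 * Q * (16 * B₁ + 16) * bs + 4 * Q) + 4 * Q)
    (h𝔴 : 𝔴 = (25 * (32 * B₂ + 144 * B₁ + 128) * bs ^ 2 + (16 * B₁ + 16) * b₂ + 8 * Q * (16 * B₁ + 16) * bs + 4 * Q) +
      ((16 * B₁ + 16) * b₂' + 8 * Q * (16 * B₁ + 16) * bs + 4 * Q) + 4 * Q)
    (hρℭ : ℭ * ρ ^ 3 ≤ 8 / π ^ 3) (hρ𝔴 : 3 * 𝔴 * ρ₃ ^ 2 ≤ 16 / π ^ 2) :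
    (4 * C₃ * ρ ^ 3 ≤ Kc ∧ 4 * C₂ * ρ ^ 3 ≤ Kc * x₀ ∧ 4 * C₁' * ρ ^ 3 ≤ Kc * x₀ ^ 2 ∧ 4 * C₀ * ρ ^ 3 ≤ Kc * x₀ ^ 3) ∧
    (4 * Cv₃ * ρ ^ 3 ≤ Kc ∧ 4 * Cv₂ * ρ ^ 3 ≤ Kc * x₀ ∧ 4 * Cv₁ * ρ ^ 3 ≤ Kc * x₀ ^ 2 ∧ 4 * Cv₀ * ρ ^ 3 ≤ Kc * x₀ ^ 3) ∧
    (3 * Cw₂ * ρ₃ ^ 2 ≤ Kw ∧ 3 * Cw₁ * ρ₃ ^ 2 ≤ Kw * x₀ ∧ 3 * Cw₀ * ρ₃ ^ 2 ≤ Kw * x₀ ^ 2) := by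
  have hπ := Real.pi_pos
  have hW1 : 1 ≤ W := hY1.trans hYW
  have hW0 : 0 ≤ W := zero_le_one.trans hW1
  have hx₀0 : 0 ≤ x₀ := hW0.trans hx₀
  have hK1 : (0 : ℝ) ≤ 16 * B₁ + 16 := by positivity
  have hK2 : (0 : ℝ) ≤ 32 * B₂ + 144 * B₁ + 128 := by positivity
  have hK3 : (0 : ℝ) ≤ 64 * B₃ + 480 * B₂ + 1728 * B₁ + 1536 := by positivity
  -- names for the four + three shape constants
  set ℭ₀ : ℝ := 343 * (64 * B₃ + 480 * B₂ + 1728 * B₁ + 1536) * bs ^ 3 + 21 * (32 * B₂ + 144 * B₁ + 128) * bs * b₂ + (16 * B₁ + 16) * b₃ +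
    3 * Q * (36 * (32 * B₂ + 144 * B₁ + 128) * bs ^ 2 + (16 * B₁ + 16) * b₂) + 15 * Q * (16 * B₁ + 16) * bs + 4 * Q with hℭ₀
  set ℭ₁ : ℝ := 21 * (32 * B₂ + 144 * B₁ + 128) * bs * b₂' + (16 * B₁ + 16) * b₃' +
    3 * Q * (36 * (32 * B₂ + 144 * B₁ + 128) * bs ^ 2 + (16 * B₁ + 16) * b₂) + 3 * Q * ((16 * B₁ + 16) * b₂') + 15 * Q * (16 * B₁ + 16) * bs + 4 * Q
    with hℭ₁
  set ℭ₂ : ℝ := 3 * Q * ((16 * B₁ + 16) * b₂') + 15 * Q * (16 * B₁ + 16) * bs + 4 * Q with hℭ₂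
  set 𝔴₀ : ℝ := 25 * (32 * B₂ + 144 * B₁ + 128) * bs ^ 2 + (16 * B₁ + 16) * b₂ + 8 * Q * (16 * B₁ + 16) * bs + 4 * Q with h𝔴₀
  set 𝔴₁ : ℝ := (16 * B₁ + 16) * b₂' + 8 * Q * (16 * B₁ + 16) * bs + 4 * Q with h𝔴₁
  have hℭ₀0 : 0 ≤ ℭ₀ := by positivity
  have hℭ₁0 : 0 ≤ ℭ₁ := by positivity
  have hℭ₂0 : 0 ≤ ℭ₂ := by positivity
  have h𝔴₀0 : 0 ≤ 𝔴₀ := by positivity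
  have h𝔴₁0 : 0 ≤ 𝔴₁ := by positivity
  have hℭe : ℭ = ℭ₀ + ℭ₁ + ℭ₂ + 4 * Q := by rw [hℭ]
  have h𝔴e : 𝔴 = 𝔴₀ + 𝔴₁ + 4 * Q := by rw [h𝔴]
  -- each shape constant obeys the rate condition
  have hρ3 : 0 ≤ ρ ^ 3 := by positivity
  have hρ₃2 : 0 ≤ ρ₃ ^ 2 := by positivity
  have cℭ₀ : ℭ₀ * ρ ^ 3 ≤ 8 / π ^ 3 := by rw [hℭe] at hρℭ; nlinarith only [hρℭ, hℭ₁0, hℭ₂0, hQ, hρ3]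
  have cℭ₁ : ℭ₁ * ρ ^ 3 ≤ 8 / π ^ 3 := by rw [hℭe] at hρℭ; nlinarith only [hρℭ, hℭ₀0, hℭ₂0, hQ, hρ3]
  have cℭ₂ : ℭ₂ * ρ ^ 3 ≤ 8 / π ^ 3 := by rw [hℭe] at hρℭ; nlinarith only [hρℭ, hℭ₀0, hℭ₁0, hQ, hρ3]
  have cℭ₃ : 4 * Q * ρ ^ 3 ≤ 8 / π ^ 3 := by rw [hℭe] at hρℭ; nlinarith only [hρℭ, hℭ₀0, hℭ₁0, hℭ₂0, hρ3]
  have c𝔴₀ : 3 * 𝔴₀ * ρ₃ ^ 2 ≤ 16 / π ^ 2 := by rw [h𝔴e] at hρ𝔴; nlinarith only [hρ𝔴, h𝔴₁0, hQ, hρ₃2]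
  have c𝔴₁ : 3 * 𝔴₁ * ρ₃ ^ 2 ≤ 16 / π ^ 2 := by rw [h𝔴e] at hρ𝔴; nlinarith only [hρ𝔴, h𝔴₀0, hQ, hρ₃2]
  have c𝔴₂ : 3 * (4 * Q) * ρ₃ ^ 2 ≤ 16 / π ^ 2 := by rw [h𝔴e] at hρ𝔴; nlinarith only [hρ𝔴, h𝔴₀0, h𝔴₁0, hρ₃2]
  -- the generic closing step: `C ≤ (c/Λ)·𝔎·W^e`, `𝔎ρ³ ≤ 8/π³` ⇒ `4Cρ³ ≤ K_c x₀^e`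
  have hcΛ : 0 ≤ c / Λ := by positivity
  have hKce : Kc = 4 * (c / Λ) * (8 / π ^ 3) := by rw [hKc]; ring
  have hKwe : Kw = c / Λ * (16 / π ^ 2) := by rw [hKw]; ring
  have closeC : ∀ {C 𝔎 : ℝ} (e : ℕ), C ≤ c / Λ * 𝔎 * W ^ e → 𝔎 * ρ ^ 3 ≤ 8 / π ^ 3 → 4 * C * ρ ^ 3 ≤ Kc * x₀ ^ e := by
    intro C 𝔎 e hC h𝔎
    have hWx : W ^ e ≤ x₀ ^ e := pow_le_pow_left₀ hW0 hx₀ e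
    calc 4 * C * ρ ^ 3 ≤ 4 * (c / Λ * 𝔎 * W ^ e) * ρ ^ 3 := by nlinarith only [hC, hρ3]
      _ = 4 * (c / Λ) * (𝔎 * ρ ^ 3) * W ^ e := by ring
      _ ≤ 4 * (c / Λ) * (8 / π ^ 3) * x₀ ^ e := mul_le_mul (mul_le_mul_of_nonneg_left h𝔎 (by positivity)) hWx (by positivity) (by positivity)
      _ = Kc * x₀ ^ e := by rw [hKce]
  have closeW : ∀ {C 𝔎 : ℝ} (e : ℕ), C ≤ c / Λ * 𝔎 * W ^ e → 3 * 𝔎 * ρ₃ ^ 2 ≤ 16 / π ^ 2 → 3 * C * ρ₃ ^ 2 ≤ Kw * x₀ ^ e := by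
    intro C 𝔎 e hC h𝔎
    have hWx : W ^ e ≤ x₀ ^ e := pow_le_pow_left₀ hW0 hx₀ e
    calc 3 * C * ρ₃ ^ 2 ≤ 3 * (c / Λ * 𝔎 * W ^ e) * ρ₃ ^ 2 := by nlinarith only [hC, hρ₃2]
      _ = (c / Λ) * (3 * 𝔎 * ρ₃ ^ 2) * W ^ e := by ring
      _ ≤ (c / Λ) * (16 / π ^ 2) * x₀ ^ e := mul_le_mul (mul_le_mul_of_nonneg_left h𝔎 (by positivity)) hWx (by positivity) (by positivity)
      _ = Kw * x₀ ^ e := by rw [hKwe]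
  -- the shapes
  have s0 := famC0_le hΛ hc hY1 hYW hΛW hQ hbs hb₂ hb₃ hK1 hK2 hK3 hk₁ hk₂ hk₃ hr₁₀ hr₂₀ hr₃₀
  have s1 := famC1_le hΛ hc hY1 hYW hΛW hQ hbs hb₂ hb₂' hb₃' hK1 hK2 hk₁ hk₂ hr₁₀ hr₁₁ hr₂₁ hr₃₁
  have s2 := famC2_le hΛ hc hY1 hYW hΛW hQ hbs hb₂' hK1 hk₁ hr₁₁ hr₂₂ hr₃₂
  have sv0 := famC0_le hΛ hc hY1 hYW hΛW hQ hbs hb₂ hb₃ hK1 hK2 hK3 hk₁ hk₂ hk₃ hrv₁₀ hrv₂₀ hrv₃₀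
  have sv1 := famC1_le hΛ hc hY1 hYW hΛW hQ hbs hb₂ hb₂' hb₃' hK1 hK2 hk₁ hk₂ hrv₁₀ hrv₁₁ hrv₂₁ hrv₃₁
  have sv2 := famC2_le hΛ hc hY1 hYW hΛW hQ hbs hb₂' hK1 hk₁ hrv₁₁ hrv₂₂ hrv₃₂
  have sw0 := famCw0_le hΛ hc hY1 hYW hΛW hQ hbs hb₂ hK1 hK2 hk₁ hk₂ hrv₁₀ hrv₂₀
  have sw1 := famCw1_le hΛ hc hY1 hYW hΛW hQ hbs hb₂' hK1 hk₁ hrv₁₁ hrv₂₁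
  have s3 : C₃ ≤ c / Λ * (4 * Q) * W ^ 0 := by
    rw [hC₃, pow_zero, mul_one]
    have e : r₃₃ * (4 * c / Λ) = c / Λ * (4 * r₃₃) := by ring
    rw [e]; exact mul_le_mul_of_nonneg_left (by linarith) hcΛ
  have sv3 : Cv₃ ≤ c / Λ * (4 * Q) * W ^ 0 := by
    rw [hCv₃, pow_zero, mul_one]
    have e : rv₃₃ * (4 * c / Λ) = c / Λ * (4 * rv₃₃) := by ring
    rw [e]; exact mul_le_mul_of_nonneg_left (by linarith) hcΛ
  have sw2 : Cw₂ ≤ c / Λ * (4 * Q) * W ^ 0 := by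
    rw [hCw₂, pow_zero, mul_one]
    have e : rv₂₂ * (4 * c / Λ) = c / Λ * (4 * rv₂₂) := by ring
    rw [e]; exact mul_le_mul_of_nonneg_left (by linarith) hcΛ
  rw [← hC₀] at s0; rw [← hC₁'] at s1; rw [← hC₂] at s2; rw [← hCv₀] at sv0; rw [← hCv₁] at sv1; rw [← hCv₂] at sv2
  rw [← hCw₀] at sw0; rw [← hCw₁] at sw1
  refine ⟨⟨?_, ?_, ?_, ?_⟩, ⟨?_, ?_, ?_, ?_⟩, ⟨?_, ?_, ?_⟩⟩
  · simpa using closeC 0 s3 cℭ₃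
  · simpa using closeC 1 (by simpa using s2) cℭ₂
  · exact closeC 2 s1 cℭ₁
  · exact closeC 3 s0 cℭ₀
  · simpa using closeC 0 sv3 cℭ₃
  · simpa using closeC 1 (by simpa using sv2) cℭ₂
  · exact closeC 2 sv1 cℭ₁
  · exact closeC 3 sv0 cℭ₀
  · simpa using closeW 0 sw2 c𝔴₂
  · simpa using closeW 1 (by simpa using sw1) c𝔴₁
  · exact closeW 2 sw0 c𝔴₀

end Summit.HubbardSuperconductivity.HubbardSuperconductivity.Theorems.TorusFourierL2

end
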